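import Summits.ResolutionOfSingularities.ResolutionOfSingularities.Theorems.DeltaCutStellarWild
import Summits.ResolutionOfSingularities.ResolutionOfSingularities.Theorems.DeltaCutStellarJetRing

/-!
# δ-cut, stellar NC-HYP arm — THE «JetCut» CLASS: a frame-logarithmic derivation seeing the jet of the unit (T19b-i)

[OURS · decomp-res-lens-6 g35 · column item `E1TopNoAbs` (stmt-ResolutionOfSingularities-26971) · PRE-BUILD NOTICE «JetCut»
(HOME/decomp-res-lens-6/g35/NOTICE-JetCut.md)]  THIS FILE: the class (§Class), logarithmic bookkeeping for bare derivations
(§Local), monomial-stalk bounds (§Book), the phase dichotomy under the star bounds (§Star).  The round engine is in the slices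
`DeltaCutStellarJetRound.lean` (T19b-ii) and `DeltaCutStellarJetStar.lean` (T19b-iii); the cells and the carving of the narrow wild
cell in `DeltaCutStellarJetLaw.lean` (T19c); the kernel inhabitant in `DeltaCutStellarJetInhabitant.lean` (T19d).  THE PLAN:

THE PROBLEM (narrow wild cell `WORNCHypWildRest`, T18): at the pure-characteristic marking `p = char` with a boundary exponent
DIVISIBLE BY `p` on the tight face, the three frames `x² + z³w²·(unit)` — Hauser's kangaroo `x² + (1+xz)z²w²`, `x² + (1+x)z²w²`,
and the clean `x² + (1+z)z²w² ~ (x+zw)² + z³w²` — are indistinguishable by every LABEL class (`IsNCHypStage 2`), yet only the last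
is resolved by the strategy: the outcome depends on the JET of the unit along the centre.

THE CLASS (`ncHypShapeJet p`, a `Shape`; T16's strategy applies to any shape): the unit-free hypersurface shape `ncHypShapeF p`
(T17a) + `p` prime + `p = 0` in the stalks + THE JET CLAUSE: at every point `y ∈ V(H)` which is `p`-DIVISIBLE for the boundary
(`DivPt p E y`: every boundary member through `y` has exponent `≡ 0 (p)`, one of them nonzero) there is a JET DATUM
(`JetAt p E H M y`): `h, m₀, r ∈ 𝒪_y` and a derivation `δ` of `𝒪_y` (a bare additive Leibniz map, `IsDeriv`, T19a) with
`H_y = (h)`, `m₀ᵖ ∈ 𝓜(E)_y`, `hᵖ + r·m₀ᵖ ∈ 𝓘_y`, `δ` LOGARITHMIC for every frame member through `y` (`δ(K_y) ⊆ K_y`), and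
`δ r` A UNIT.  (Clean frame: `h = x+zw`, `m₀ = w`, `r = z³`, `δ = ∂_z` (Leibniz-twisted so that `δ h = 0`), `δ r = 3z² = z²` a unit
off `V(z)`; the kangaroos admit no datum at the origin: every log derivation kills the jet of `1 + xz`, `1 + x` modulo `𝔪`.)

THE ROUND LEMMA ALONG THE STRATEGY (`ncHypShapeJet.transform_star`, star bounds `(*ₛ)^H`):
* GUARD `supp M' ⊆ V(H')` (`support_transform_subset`): a SAFE face is T17b; an UNSAFE face is tight with one member of exponent
  `p`; at `x'` over the centre and off `V(H')`, with `y = π x'`: if `y` is `p`-divisible, the NEAR-POINT LEMMA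
  (`JetAt.not_transform_le_sq`: `ε := π^*h` generates `C_y𝒪'`, `π^*m₀ = w·ε`, `G := 1 + π^*(r)·wᵖ ∈ 𝓘'_{x'}`; the derivation
  extends to `𝒪'` through the blow-up chart (T19a + `IsBlowup.exists_reesChart_stalk`) with `δ' ∘ π^* = π^* ∘ δ`; `𝓘' ⊆ 𝔪²`
  would give `δ'G = wᵖ·π^*(δ r) ∈ 𝔪` (`p = 0` kills `δ'(wᵖ)`), so `w ∈ 𝔪` and `G ≡ 1` — a unit in `𝓘' ⊆ 𝔪²`); if not, some member
  `K' ∉ T` through `y` has exponent prime to `p`, and the DULL LEMMA (`not_transform_le_sq_of_dull`: `𝓜_y ⊆ C_yᵖ·𝔪_y`, so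
  `𝓘'_{x'} ∋ 1 + unit·t`, `t ∈ 𝔪`) makes `𝓘'_{x'} = 𝒪'`.
* TRANSPORT of the jet clause (`JetAt.transform` + `divPt_of_divPt_transform`): a `p`-divisible point `x' ∈ V(H')` lies over a
  `p`-divisible point (label arithmetic under the star bounds: phase 2 directly, phase `≥ 3` has no such points), and the datum
  moves: `h' = h₀·v`, `r' = π^*r`, `π^*m₀ = m₁·ε` with `m₁ᵖ ∈ 𝓜(E')_{x'}` (cancel `εᵖ` in the domain `𝒪'`), `δ'` the chart extension,
  logarithmic for `F = (ε)`, for the strict transforms of members `∉ T` (total = strict) and `∈ T` (cancel `ε`).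
* `faceStableShapeStar_ncHypShapeJet p : FaceStableShapeStar p (ncHypShapeJet p)` and the list-level law
  `exists_weakResolution_of_ncHypShapeJet`.

0 sorry; axioms standard. [new] [cite: Hauser2010, §§3–5] [cite: Kollar2007, (3.111) Step 3] [cite: CossartPiltant2008, Prop. 4.2 (a)]
[cite: Matsumura1986, §25] [cite: StacksProject, Tag 0804]
-/
noncomputable section

open CategoryTheory CategoryTheory.Limits AlgebraicGeometry TopologicalSpace IsLocalRing
open Literature.AlgebraicGeometry.Resolution

namespace Summit.ResolutionOfSingularities.ResolutionOfSingularities.Theorems.DeltaCutClasses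

open Summit.ResolutionOfSingularities.ResolutionOfSingularities.Theorems
open WeakOrderReduction ForcedTowerClasses

/-! ### §Local — logarithmic bookkeeping for bare derivations -/

section Local

variable {A : Type*} [CommRing A] {δ : A → A}

/-- a derivation mapping a generating set into the ideal it spans maps the ideal into itself. [folklore] -/
theorem IsDeriv.log_span (h : IsDeriv δ) {S : Set A} (hS : ∀ s ∈ S, δ s ∈ Ideal.span S) {x : A}
    (hx : x ∈ Ideal.span S) : δ x ∈ Ideal.span S := by
  induction hx using Submodule.span_induction with
  | mem y hy => exact hS y hy
  | zero => rw [h.map_zero]; exact Submodule.zero_mem _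
  | add y z _ _ hy hz => rw [h.map_add]; exact Ideal.add_mem _ hy hz
  | smul r y hy' hy =>
    rw [smul_eq_mul, h.leibniz]
    exact Ideal.add_mem _ (Ideal.mul_mem_left _ _ hy) (Ideal.mul_mem_right _ _ hy')

/-- **log along a ring map**: if `δ ∘ φ = φ ∘ δ₀` and `δ₀(J) ⊆ J` then `δ(J·A) ⊆ J·A`. [folklore] -/
theorem IsDeriv.log_map {R : Type*} [CommRing R] {δ₀ : R → R} (φ : R →+* A) (h : IsDeriv δ)
    (hcomm : ∀ a, δ (φ a) = φ (δ₀ a)) {J : Ideal R} (hJ : ∀ g ∈ J, δ₀ g ∈ J) {x : A} (hx : x ∈ J.map φ) :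
    δ x ∈ J.map φ := by
  rw [Ideal.map] at hx ⊢
  refine h.log_span (fun s hs => ?_) hx
  obtain ⟨g, hg, rfl⟩ := hs
  rw [hcomm]
  exact Ideal.subset_span ⟨δ₀ g, hJ g hg, rfl⟩

/-- log for a sup of two ideals. [folklore] -/
theorem IsDeriv.log_sup (h : IsDeriv δ) {I J : Ideal A} (hI : ∀ g ∈ I, δ g ∈ I) (hJ : ∀ g ∈ J, δ g ∈ J) {x : A}
    (hx : x ∈ I ⊔ J) : δ x ∈ I ⊔ J := by
  obtain ⟨a, ha, b, hb, rfl⟩ := Submodule.mem_sup.mp hx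
  rw [h.map_add]
  exact Submodule.add_mem_sup (hI a ha) (hJ b hb)

/-- log for a finite sup of ideals. [folklore] -/
theorem IsDeriv.log_finsetSup (h : IsDeriv δ) {ι : Type*} (T : Finset ι) (J : ι → Ideal A)
    (hJ : ∀ i ∈ T, ∀ g ∈ J i, δ g ∈ J i) : ∀ x ∈ T.sup J, δ x ∈ T.sup J := by
  classical
  induction T using Finset.induction_on with
  | empty =>
    intro x hx
    rw [Finset.sup_empty, Submodule.mem_bot] at hx ⊢
    rw [hx, h.map_zero]
  | insert i T hi ih =>
    intro x hx
    rw [Finset.sup_insert] at hx ⊢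
    exact h.log_sup (hJ i (Finset.mem_insert_self i T)) (ih fun i' hi' => hJ i' (Finset.mem_insert_of_mem hi')) hx

/-- **cancelling a nonzero log parameter**: in a domain, if `δ ε ∈ (ε)`, `ε ≠ 0` and `δ(J·(ε)) ⊆ J·(ε)`, then `δ(J) ⊆ J`.
[folklore] -/
theorem IsDeriv.log_of_log_mul [IsDomain A] (h : IsDeriv δ) {ε : A} (hε : ε ≠ 0) (hεlog : δ ε ∈ Ideal.span {ε})
    {J : Ideal A} (hJ : ∀ x ∈ J * Ideal.span {ε}, δ x ∈ J * Ideal.span {ε}) {g : A} (hg : g ∈ J) : δ g ∈ J := by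
  have h1 : δ (g * ε) ∈ J * Ideal.span {ε} := hJ _ (Ideal.mul_mem_mul hg (Ideal.mem_span_singleton_self ε))
  rw [h.leibniz] at h1
  have h2 : g * δ ε ∈ J * Ideal.span {ε} := Ideal.mul_mem_mul hg hεlog
  have h3 : ε * δ g ∈ J * Ideal.span {ε} := (Submodule.add_mem_iff_right _ h2).mp h1
  obtain ⟨t, ht, hte⟩ := Ideal.mem_mul_span_singleton.mp h3
  have : δ g = t := mul_left_cancel₀ hε (by rw [← hte]; ring)
  rw [this]
  exact ht

end Local

/-! ### §Book — exponents, boundary members, monomial stalks -/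

section Book

variable {X : Scheme.{0}}

/-- a sheaf with a nonzero exponent is a boundary member. [folklore] -/
theorem mem_boundaryOf_of_expOf_ne_zero {E : List (X.IdealSheafData × ℕ)} {K : X.IdealSheafData} (h : expOf E K ≠ 0) :
    K ∈ boundaryOf E := by
  classical
  induction E with
  | nil => simp at h
  | cons q E ih =>
    rw [expOf_cons] at h
    by_cases hq : q.1 = K
    · exact List.mem_cons.mpr (Or.inl hq.symm)
    · rw [if_neg hq, zero_add] at h
      exact List.mem_cons_of_mem _ (ih h)

/-- a face of nonzero weight has a member of nonzero exponent. [folklore] -/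
theorem exists_mem_expOf_ne_zero_of_weightOf_ne_zero {E : List (X.IdealSheafData × ℕ)} {T : Finset X.IdealSheafData}
    (h : weightOf E T ≠ 0) : ∃ K ∈ T, expOf E K ≠ 0 := by
  rw [← sum_expOf_eq_weightOf] at h
  exact Finset.exists_ne_zero_of_sum_ne_zero h

/-- **`𝓜(E)_y ⊆ K_y^{expOf E K}`.** [folklore] -/
theorem stalkIdeal_monomialIdeal_le_pow (E : List (X.IdealSheafData × ℕ)) (K : X.IdealSheafData) (y : X) :
    stalkIdeal (monomialIdeal E) y ≤ stalkIdeal K y ^ expOf E K := by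
  classical
  induction E with
  | nil => rw [expOf_nil, pow_zero, Ideal.one_eq_top]; exact le_top
  | cons q E ih =>
    rw [monomialIdeal_cons, stalkIdeal_mul, stalkIdeal_pow, expOf_cons]
    by_cases hq : q.1 = K
    · rw [if_pos hq, pow_add, hq]
      exact Ideal.mul_mono le_rfl ih
    · rw [if_neg hq, zero_add]
      exact Ideal.mul_le_left.trans ih

/-- **`𝓜(E)_y ⊆ K_y^{expOf E K} · K'_y^{expOf E K'}`** for two different sheaves. [folklore] -/
theorem stalkIdeal_monomialIdeal_le_pow_mul_pow (E : List (X.IdealSheafData × ℕ)) {K K' : X.IdealSheafData} (hne : K ≠ K')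
    (y : X) : stalkIdeal (monomialIdeal E) y ≤ stalkIdeal K y ^ expOf E K * stalkIdeal K' y ^ expOf E K' := by
  classical
  induction E with
  | nil => rw [expOf_nil, expOf_nil, pow_zero, pow_zero, one_mul, Ideal.one_eq_top]; exact le_top
  | cons q E ih =>
    rw [monomialIdeal_cons, stalkIdeal_mul, stalkIdeal_pow, expOf_cons, expOf_cons]
    by_cases hq : q.1 = K
    · have hq' : q.1 ≠ K' := hq ▸ hne
      rw [if_pos hq, if_neg hq', zero_add, pow_add, hq, mul_assoc]
      exact Ideal.mul_mono le_rfl ih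
    · by_cases hq' : q.1 = K'
      · rw [if_neg hq, if_pos hq', zero_add, pow_add, hq', mul_left_comm]
        exact Ideal.mul_mono le_rfl ih
      · rw [if_neg hq, if_neg hq', zero_add, zero_add]
        exact Ideal.mul_le_left.trans ih

end Book

/-! ### §Class — `DivPt`, `JetAt`, the shape `ncHypShapeJet p` -/

section Class

variable {X : Scheme.{0}}

/-- **`DivPt p E y` — a `p`-DIVISIBLE POINT of the labelled boundary**: every sheaf through `y` has `E`-exponent `≡ 0 (mod p)`
(sheaves outside the boundary have exponent `0`), and some sheaf through `y` has a nonzero exponent. -/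
def DivPt (p : ℕ) (E : List (X.IdealSheafData × ℕ)) (y : X) : Prop :=
  (∀ K : X.IdealSheafData, y ∈ K.support → p ∣ expOf E K) ∧ ∃ K : X.IdealSheafData, y ∈ K.support ∧ expOf E K ≠ 0

/-- **`JetAt p E H I y` — a JET DATUM at `y` for the ideal sheaf `I`**: `h, m₀, r ∈ 𝒪_y` and a derivation `δ` of `𝒪_y` with
`H_y = (h)`, `m₀ᵖ ∈ 𝓜(E)_y`, `hᵖ + r·m₀ᵖ ∈ I_y`, `δ` logarithmic for every member of the frame `H :: boundaryOf E` through `y`, and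
`δ r` a unit. -/
def JetAt (p : ℕ) (E : List (X.IdealSheafData × ℕ)) (H I : X.IdealSheafData) (y : X) : Prop :=
  ∃ (h m₀ r : X.presheaf.stalk y) (δ : X.presheaf.stalk y → X.presheaf.stalk y), IsDeriv δ ∧
    stalkIdeal H y = Ideal.span {h} ∧ m₀ ^ p ∈ stalkIdeal (monomialIdeal E) y ∧
    h ^ p + r * m₀ ^ p ∈ stalkIdeal I y ∧
    (∀ K ∈ H :: boundaryOf E, y ∈ K.support → ∀ g ∈ stalkIdeal K y, δ g ∈ stalkIdeal K y) ∧ IsUnit (δ r)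

/-- **THE JET SHAPE `ncHypShapeJet p`** (a `Shape`): the unit-free hypersurface shape at marking `p` (T17a), `p` prime, `p = 0` in
every stalk, and a jet datum at every `p`-divisible point of `V(H)`. -/
def ncHypShapeJet (p : ℕ) : Shape := fun X E H M =>
  ncHypShapeF p X E H M ∧ p.Prime ∧ (∀ x : X, ((p : ℕ) : X.presheaf.stalk x) = 0) ∧
    ∀ y : X, y ∈ H.support → DivPt p E y → JetAt p E H M.ideal y

namespace ncHypShapeJet

variable {E : List (X.IdealSheafData × ℕ)} {H : X.IdealSheafData} {p : ℕ} {M : MarkedIdeal X}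

/-- the underlying unit-free shape -/
theorem toF (hP : ncHypShapeJet p X E H M) : ncHypShapeF p X E H M := hP.1

/-- `p` is prime -/
theorem prime (hP : ncHypShapeJet p X E H M) : p.Prime := hP.2.1

/-- `p = 0` in every stalk -/
theorem cast_eq_zero (hP : ncHypShapeJet p X E H M) (x : X) : ((p : ℕ) : X.presheaf.stalk x) = 0 := hP.2.2.1 x

/-- the jet datum at a `p`-divisible point of `V(H)` -/
theorem jet (hP : ncHypShapeJet p X E H M) {y : X} (hy : y ∈ H.support) (hD : DivPt p E y) : JetAt p E H M.ideal y :=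
  hP.2.2.2 y hy hD

end ncHypShapeJet

/-- **the coprime shape is a jet shape** (T18's wide class: no point of a coprime-labelled boundary is `p`-divisible). [new] -/
theorem ncHypShapeCop.toJet {E : List (X.IdealSheafData × ℕ)} {H : X.IdealSheafData} {p : ℕ} {M : MarkedIdeal X}
    (hP : ncHypShapeCop p X E H M) : ncHypShapeJet p X E H M := by
  refine ⟨hP.toF, hP.prime, hP.cast_eq_zero, fun y _ hD => ?_⟩
  obtain ⟨hdiv, K, hyK, hK0⟩ := hD
  exact absurd (hdiv K hyK) fun h => ((hP.labels hyK).resolve_left hK0) h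

end Class

/-! ### §Star — label arithmetic under the star bounds -/

section Star

variable {X : Scheme.{0}} {E : List (X.IdealSheafData × ℕ)} {H : X.IdealSheafData} {T : Finset X.IdealSheafData} {p : ℕ}

/-- **PHASE DICHOTOMY under `(*ₛ)^H`.**  For an `r`-set `T ∋ H` with a common point, weight `≥ p > 0` and `expOf E H = 0`:
EITHER `T = {H, K₀}` with `weightOf E T = expOf E K₀` (phase 2), OR (phase `≥ 3`) `weightOf E T < 2p` and every boundary sheaf
`K ≠ H` meeting `V(H)` has exponent `< p`. [new] [cite: Kollar2007, (3.111) Step 3] -/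
theorem star_dichotomy {r : ℕ} (hTrH : T ∈ incSubsetsH E H r) (hstar : StarBelowH E H p r) (hH0 : expOf E H = 0)
    (hpT : p ≤ weightOf E T) (hp : 0 < p) :
    (∃ K₀ ∈ T, K₀ ≠ H ∧ weightOf E T = expOf E K₀ ∧ ∀ K ∈ T, K ≠ H → K = K₀) ∨
    (weightOf E T < 2 * p ∧
      ∀ K ∈ sheaves E, K ≠ H → ∀ y : X, y ∈ H.support → y ∈ K.support → expOf E K < p) := by
  classical
  obtain ⟨hTr, hHT⟩ := mem_incSubsetsH_iff.mp hTrH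
  obtain ⟨hTs, hcard, x, hx⟩ := mem_incSubsets_iff.mp hTr
  set S := T.erase H with hS
  have hWS : weightOf E T = weightOf E S := by
    have h := weightOf_insert E (Finset.notMem_erase H T) (K := H)
    rw [Finset.insert_erase hHT, hH0, zero_add] at h
    exact h
  by_cases hS1 : S.card ≤ 1
  · -- phase `≤ 2`
    left
    obtain ⟨K, hSK⟩ := Finset.card_le_one_iff_subset_singleton.mp hS1
    rcases Finset.subset_singleton_iff.mp hSK with hS0 | hSeq
    · rw [hWS, hS0, weightOf_empty] at hpT
      omega
    · have hKS : K ∈ S := by rw [hSeq]; exact Finset.mem_singleton_self K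
      refine ⟨K, Finset.mem_of_mem_erase hKS, Finset.ne_of_mem_erase hKS, by rw [hWS, hSeq]; rfl, fun K' hK' hK'H => ?_⟩
      have : K' ∈ S := Finset.mem_erase.mpr ⟨hK'H, hK'⟩
      rw [hSeq] at this
      exact Finset.mem_singleton.mp this
  · -- phase `≥ 3`
    right
    push Not at hS1
    obtain ⟨K, hKS⟩ : S.Nonempty := Finset.card_pos.mp (by omega)
    have hKT : K ∈ T := Finset.mem_of_mem_erase hKS
    have hKH : K ≠ H := Finset.ne_of_mem_erase hKS
    have hST : S.card + 1 = T.card := Finset.card_erase_add_one hHT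
    have hr3 : 3 ≤ r := by omega
    have h1 : weightOf E (T.erase K) < p :=
      hstar (r - 1) (by omega) _ (mem_incSubsets_iff.mpr ⟨(Finset.erase_subset K T).trans hTs,
        by rw [Finset.card_erase_of_mem hKT, hcard], x, fun K' hK' => hx K' (Finset.mem_of_mem_erase hK')⟩)
        (Finset.mem_erase.mpr ⟨hKH.symm, hHT⟩)
    have hpair : ∀ K₁ ∈ sheaves E, K₁ ≠ H → ∀ y : X, y ∈ H.support → y ∈ K₁.support → weightOf E {H, K₁} < p := by
      intro K₁ hK₁ hK₁H y hyH hyK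
      refine hstar 2 (by omega) _ (mem_incSubsets_iff.mpr ⟨?_, Finset.card_pair hK₁H.symm, y, fun K' hK' => ?_⟩)
        (Finset.mem_insert_self H {K₁})
      · exact Finset.insert_subset_iff.mpr ⟨hTs hHT, Finset.singleton_subset_iff.mpr hK₁⟩
      · rcases Finset.mem_insert.mp hK' with rfl | hK'
        · exact hyH
        · rw [Finset.mem_singleton.mp hK']; exact hyK
    have h2 : weightOf E {H, K} < p := hpair K (hTs hKT) hKH x (hx _ hHT) (hx _ hKT)
    have hWK : weightOf E T = expOf E K + weightOf E (T.erase K) := by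
      have h := weightOf_insert E (Finset.notMem_erase K T) (K := K)
      rw [Finset.insert_erase hKT] at h
      exact h
    have hKle : expOf E K ≤ weightOf E {H, K} := weightOf_mono E (Finset.subset_insert H {K})
    refine ⟨by omega, fun K₁ hK₁ hK₁H y hyH hyK => ?_⟩
    exact lt_of_le_of_lt (weightOf_mono E (Finset.subset_insert H {K₁})) (hpair K₁ hK₁ hK₁H y hyH hyK)

end Star

end Summit.ResolutionOfSingularities.ResolutionOfSingularities.Theorems.DeltaCutClasses

end
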